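import Summits.Ventures.PercRepro.GenQAllFlat
import Summits.Ventures.PercRepro.GenQTypeOneB
import Summits.Ventures.PercRepro.GenQTypeTwoB
import Summits.Ventures.PercRepro.GenQSixFourFinal

/-!
# PercRepro — C-025 at `(q + 2, q)`: the OPEN LAYERS of every diagonal row `q ≤ 9`, in the kernel (night-4, gen 2)

`rls_succ_succ_all_flat` (`GenQAllFlat.lean`) reduces the row `(q + 2, q)` on every finite matroid to the per-flat
balances `PerFlatResidueBelowFlat q'` for `4 ≤ q' ≤ q` — the hard max-trace balance `0 ≤ Jq M G q' t` at EVERY type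
`t ≤ q' − 1` on the rank-`q'` flats of simple matroids covered by two hyperplane traces and two points (mine-2's `𝔉`).
Since then several types have been closed in the kernel at every `q`: `t = 0` (`Jq_zero_nonneg`), `t = 1` for `q ≤ 5`
(`Jq_one_nonneg_of_le_five`) and for `g ≤ q + 1` or `(g − q)(q + 3) + 1 ≥ q²` in general
(`Jq_one_nonneg_of_card_le_succ`,
`Jq_one_nonneg`), `t = 2` for `(g − q)(g − q + 3) ≥ 12 (q − 1)` (`Jq_two_nonneg'`), and level `4` entirely
(`residueBelowFlat_four_of_typeThree` with `typeThreeSmall_holds` / `twentyOnePrime_holds`).  This file records what is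
LEFT, as one `Prop` per level:

* `OpenLayers q` — on every rank-`q` flat `G ∈ 𝔉_q` of a simple matroid: the balances at the types `3 ≤ t ≤ q − 1`,
  the type-`2` balance when `(g − q)(g − q + 3) < 12 (q − 1)`, and (for `q ≥ 6` only) the type-`1` balance when
  `q + 2 ≤ g` and `(g − q)(q + 3) + 1 < q²`;
* `perFlatResidueBelowFlat_of_openLayers`: `OpenLayers q → PerFlatResidueBelowFlat q` (`q ≥ 2`), and the converse
  `openLayers_of_perFlatResidueBelowFlat` — for `q ≥ 3` the two are equivalent
  (`perFlatResidueBelowFlat_iff_openLayers`);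
* `rls_succ_succ_of_openLayers`: the row `(q + 2, q)` on EVERY finite matroid from `OpenLayers q'` for `5 ≤ q' ≤ q`
  (level `4` is discharged);
* `SevenFiveLayers` — the first open row `(7, 5)` spelled out: on every rank-`5` flat in `𝔉_5` the type-`2` balance
  when `g ≤ 10`, and the type-`3` and type-`4` balances; `rls_seven_five_of_layers : SevenFiveLayers → ∀ M, RLS M 7 5`.

Scope (mine-4's refutation of record, RULING (rc)): the hypothesis `PerFlatResidueBelowFlat q` is FALSE for `q ≥ 10`
(stars of lines), so these statements are the exact kernel residue of the rows `(7, 5) … (11, 9)` and say nothing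
beyond `q = 9`.  Imports: the landed `GenQAllFlat`, `GenQTypeOneB`, `GenQTypeTwoB`, `GenQSixFourFinal` (for
`twentyOnePrime_holds`) only.
-/

namespace PercRepro.GenQ

open Finset ThmH PerFlat SixFour ThmN

/-- **The open layers of level `q`**: on every rank-`q` flat `G` of a simple matroid that is covered by two hyperplane
traces and two points (`TwoHyp`), (i) for `q ≥ 6`, the type-`1` balance on the window `q + 2 ≤ g`,
`(g − q)(q + 3) + 1 < q²`; (ii) the type-`2` balance on the window `(g − q)(g − q + 3) < 12 (q − 1)`;
(iii) the balances at every type `3 ≤ t ≤ q − 1`. -/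
def OpenLayers (q : ℕ) : Prop :=
  ∀ {β : Type} [DecidableEq β] (M : Matroid β) [M.Finite] (G : Finset β), Simple M → G ∈ flatsQ M q →
    TwoHyp M G q →
      (6 ≤ q → q + 2 ≤ G.card → (G.card - q) * (q + 3) + 1 < q * q → 0 ≤ Jq M G q 1) ∧
      ((G.card - q) * (G.card - q + 3) < 12 * (q - 1) → 0 ≤ Jq M G q 2) ∧
      (∀ t, 3 ≤ t → t + 1 ≤ q → 0 ≤ Jq M G q t)

/-- **The per-flat residue of level `q` from its open layers**: the types `0`, `1`, `2` outside the windows are the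
landed theorems `Jq_zero_nonneg`, `Jq_one_nonneg_of_le_five` / `Jq_one_nonneg_of_card_le_succ` / `Jq_one_nonneg`,
`Jq_two_nonneg'`. -/
theorem perFlatResidueBelowFlat_of_openLayers {q : ℕ} (hq : 2 ≤ q) (h : OpenLayers q) :
    PerFlatResidueBelowFlat q := by
  intro β _ M _ G hs hG hF t ht
  have hGg : G ⊆ gr M := (mem_flatsQ.1 hG).1
  have hr : M.eRk (G : Set β) = (q : ℕ∞) := (mem_flatsQ.1 hG).2.2
  obtain ⟨h1, h2, h3⟩ := h M G hs hG hF
  rcases t with _ | _ | _ | t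
  · exact Jq_zero_nonneg hGg q
  · by_cases hq5 : q ≤ 5
    · exact Jq_one_nonneg_of_le_five hs hGg hr hq hq5
    · by_cases hg : G.card ≤ q + 1
      · exact Jq_one_nonneg_of_card_le_succ hs hGg hr hq hg
      · by_cases hthr : q * q ≤ (G.card - q) * (q + 3) + 1
        · exact Jq_one_nonneg hs hGg hr hq hthr
        · exact h1 (by omega) (by omega) (by omega)
  · by_cases hthr : 12 * (q - 1) ≤ (G.card - q) * (G.card - q + 3)
    · exact Jq_two_nonneg' hs hGg hr hq hthr
    · exact h2 (by omega)
  · exact h3 (t + 3) (by omega) ht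

/-- Conversely the per-flat residue contains its open layers (`q ≥ 3`). -/
theorem openLayers_of_perFlatResidueBelowFlat {q : ℕ} (hq : 3 ≤ q) (h : PerFlatResidueBelowFlat q) :
    OpenLayers q := by
  intro β _ M _ G hs hG hF
  exact ⟨fun _ _ _ => h M G hs hG hF 1 (by omega), fun _ => h M G hs hG hF 2 (by omega),
    fun t _ ht => h M G hs hG hF t ht⟩

/-- **For `q ≥ 3` the two are EQUIVALENT**: `OpenLayers q` is exactly what is left of `PerFlatResidueBelowFlat q`
after the landed type-`0`, `1`, `2` theorems. -/
theorem perFlatResidueBelowFlat_iff_openLayers {q : ℕ} (hq : 3 ≤ q) :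
    PerFlatResidueBelowFlat q ↔ OpenLayers q :=
  ⟨openLayers_of_perFlatResidueBelowFlat hq, perFlatResidueBelowFlat_of_openLayers (by omega)⟩

/-- **The row `(q + 2, q)` on every finite matroid from the open layers of the levels `5 … q`** (`q ≥ 3`): level `3`
is `perFlatBelowFlat_three`, level `4` is `residueBelowFlat_four_of_typeThree` with the landed `typeThreeSmall_holds`
and `twentyOnePrime_holds`, and every level `q' ≥ 5` is `perFlatResidueBelowFlat_of_openLayers`. -/
theorem rls_succ_succ_of_openLayers {α : Type} [DecidableEq α] (q : ℕ) (hq : 3 ≤ q)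
    (h : ∀ q', 5 ≤ q' → q' ≤ q → OpenLayers q') (M : Matroid α) [M.Finite] : RLS M (q + 2) q := by
  apply rls_succ_succ_all_flat q hq
  intro q' hq'4 hq'q
  by_cases h4 : q' = 4
  · obtain rfl := h4
    exact residueBelowFlat_four_of_typeThree typeThreeSmall_holds twentyOnePrime_holds
  · exact perFlatResidueBelowFlat_of_openLayers (by omega) (h q' (by omega) hq'q)

/-- **The open layers of the first open row `(7, 5)`**, spelled out: on every rank-`5` flat `G` of a simple matroid
covered by two hyperplane traces and two points, the type-`2` balance when `G` has at most `10` points, and the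
type-`3` and type-`4` balances. -/
def SevenFiveLayers : Prop :=
  ∀ {β : Type} [DecidableEq β] (M : Matroid β) [M.Finite] (G : Finset β), Simple M → G ∈ flatsQ M 5 →
    TwoHyp M G 5 → (G.card ≤ 10 → 0 ≤ Jq M G 5 2) ∧ 0 ≤ Jq M G 5 3 ∧ 0 ≤ Jq M G 5 4

/-- `SevenFiveLayers` is `OpenLayers 5`: the type-`1` clause is vacuous (`6 ≤ 5`), and the type-`2` window
`(g − 5)(g − 2) < 48` is exactly `g ≤ 10`. -/
theorem openLayers_five_of_sevenFiveLayers (h : SevenFiveLayers) : OpenLayers 5 := by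
  intro β _ M _ G hs hG hF
  obtain ⟨h2, h3, h4⟩ := h M G hs hG hF
  refine ⟨fun h6 => absurd h6 (by norm_num), ?_, ?_⟩
  · intro hwin
    apply h2
    by_contra hg
    push Not at hg
    have h6 : 6 ≤ G.card - 5 := by omega
    have h9 : 9 ≤ G.card - 5 + 3 := by omega
    have := Nat.mul_le_mul h6 h9
    omega
  · intro t ht3 ht
    have : t = 3 ∨ t = 4 := by omega
    rcases this with rfl | rfl
    · exact h3
    · exact h4

/-- **C-025 at `(7, 5)` on every finite matroid from the open layers of level `5`** (`SevenFiveLayers`): the type-`0`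
balance, the type-`1` balance (`Jq_one_nonneg_of_le_five`), the type-`2` balance for `g ≥ 11` (`Jq_two_nonneg'`), the
dichotomy off `𝔉_5` (`Jq_nonneg_of_not_twoHyp`), level `4` (the `(6, 4)` chain) and night-1's `|E|`-induction frame
are in the kernel; what is left is exactly `SevenFiveLayers`. -/
theorem rls_seven_five_of_layers {α : Type} [DecidableEq α] (h : SevenFiveLayers) (M : Matroid α) [M.Finite] :
    RLS M 7 5 := by
  refine rls_succ_succ_of_openLayers 5 (by norm_num) ?_ M
  intro q' hq'5 hq'
  obtain rfl : q' = 5 := by omega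
  exact openLayers_five_of_sevenFiveLayers h

/-- **C-025 at `(7, 5)` in the set-builder spelling of `C025`**, from `SevenFiveLayers`. -/
theorem c025_seven_five_of_layers {α : Type} [DecidableEq α] (h : SevenFiveLayers) (M : Matroid α) [M.Finite] :
    phiK 7 5 * ({A : Set α | A ⊆ M.E ∧ M.eRk A = ((7 : ℕ) : ℕ∞) ∧ M.eRk (M.E \ A) = ((5 : ℕ) : ℕ∞)}.ncard : ℚ) ≤
      ({A : Set α | A ⊆ M.E ∧ ((5 : ℕ) : ℕ∞) < M.eRk A ∧ M.eRk A < ((7 : ℕ) : ℕ∞)}.ncard : ℚ) := by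
  have h' := rls_seven_five_of_layers h M
  unfold ThmN.RLS at h'
  exact h'

end PercRepro.GenQ
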